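import Summits.QuantumFields.BalabanUV.T4Continuum.Support.ShellMeasureCommutatorCovDatum

/-!
# `T4Continuum.ShellMeasureReadOutsMax` — W-i's READ-OUT ROWS R12∕R13 IN KERNEL ON THE (98) SOURCE SPACE:
# the plaquette's four (Ad-twisted) lattice-angle read-outs on `WMax w w′ (covD Λ η U₀)`, their op-norms `≤ η∕w₀`,
# and the STOKES IDENTITY «sum of the four read-outs = η²·(D_μA_ν − D_νA_μ)» ⟹ curl op-norm `≤ 2η²∕w₀′²`
(cell `pub-balaban`, sub-cell `t4`, spine estimate NE7c (node U5b); NE7c ROUND-2 crew, unit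
`b2b-balaban-t4-ne7c-formalise-leaf-08` gen 17; journal OFFER O-ne7cleaf08-g17-1 (l.21839), COLLISION NOTE C-ne7cleaf08-g17-1
(l.22078, with leaf-05-g11's O-ne7cL05g11-1 — same junction, priority-in-time here, leaf-05 yields and cross-reads), owner
table `t4/b2b-balaban-t4-ne7c-p1/LEAVES-NE7c-P1.md` **ROW S109 «W-i READ-OUT ROWS ON THE (19)∕(98) SOURCE SPACE»**, file f1
(RULING R-ne7cp1-g36-12 (4), l.22193: «f1 GO NOW; f2 = the host wrapper over link (3) of the junction chain»); ADDITIVE —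
imports the leaf-02 lineage's S65 f5b
`ShellMeasureCommutatorCovDatum` (hence S65 f2a∕f2c `ShellMeasureMultiGridNorms(Max)`) ONLY, read BY NAME, nothing of it
rewritten; [folklore]; DATA only: two `def`s on the flat space (`rdOutPi`, `plaqReadOutsPi`), two `abbrev`s (`Ysp` = the
max-normed carrier with its type arguments explicit, `flat` = its identity to the flat space), the two max-normed twins
(`rdOut`, `plaqReadOuts`) and one `instance` (completeness of the carrier); 0 `def … : Prop`, 0 sorry, 0 citation tags;
owner ruling R-ne7cp1-g36-12 (4): ROW S109 f1)

HONEST FRAMING.  Finite four-torus programme, rung (B)+1 only — NOT infinite volume, NOT a mass gap, NOT the Clay problem,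
NOT summit progress; (B), `BetaPertHyp`, (B^μ) are not consumed.  NE7c (`T4IndicatorShell.ShellWeightBound`) is NOT PRINTED
in [Balaban 1983–89] and NOT PROVED; «NE7c ⇐ the named binders» (trigger c3).  This file is OUR threading of read-outs that
are COORDINATE EVALUATIONS BY CONSTRUCTION; nothing of Bałaban's is asserted or discharged; equation numbers LOCATE displayed
shapes, they are not citations.  HONEST DEPENDENCY (cell): continuum YM on T⁴ ⇐ BetaPertH ∧ nine spine estimates (0/9
proved); BetaPertH ⇐ (D1) ∧ (D4) ∧ CAP+tail; G-an2-4 gates asym, D1 and NE2/3/4.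

THE POINT (WALL `t4/b2b-balaban-t4-ne7c-p1/WALL-NE7c-P1.md` §2b rows R12∕R13, census `ONECALL-CENSUS-NE7c.md` v1.8 §9).  The
END-II hosts of record (S80 f6 → S99 f3b → S104 f2 `…AssembledDecayCfLin`) display, for an ABSTRACT complete normed space
`𝒴` carrying the localized scheme's section field, the classifier READ-OUTS `ℓs p : List (𝒴 →L[ℂ] M_n(ℂ))` with
`hℓ : ‖ℓ Y‖ ≤ κr‖Y‖`, `hlen : length ≤ m`, and (F-ne7cp1-g31-1, S73) the CURL read-out `hcurl : ‖((ℓs p).map (· Y)).sum‖ ≤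
κc‖Y‖`, with the (SM) rows `ha : κr·X ≤ c₂·η·zs`, `hs₁ : κc·X ≤ c₁·η²·zs`, `hma : m·κr·X ≤ 1` forcing the LIFT-RULE profiles
`κr ∝ η_j`, `κc ∝ η_j²` (F-ne7cL05g9-1 ∕ F-ne7cp1-g34-1, S95 `levelIndexed_rows`).  In the designed reading `𝒴` IS the (98)
source space `max{|A|_{(−1)}, |∇^η_{U₀}A|_{(−2)}}` of [Balaban1985Variational] — typed by the leaf-02 lineage as
`WMax w w′ (covD Λ η U₀)` (S65 f2c + f5b) — and a read-out IS the lattice angle `η·A(b)` of a bond of `∂p` (B14 (2.16)∕(2.17):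
the letter `holOf` exponentiates).  On that space the three rows are KERNEL facts about coordinate projections:
* §1 (flat space `↥Λ → 𝔸`, DATA): `rdOutPi Λ η x μ := (η:ℂ) • extL Λ x μ` and the plaquette's list `plaqReadOutsPi Λ η U₀ x μ ν
  := [rdOut (x,μ), Ad_{U₀(x,μ)} ∘ rdOut (x+e_μ, ν), −Ad_{U₀(x,ν)} ∘ rdOut (x+e_ν, μ), −rdOut (x,ν)]` (at the flat background
  `U₀ ≡ 1` the plain four letters of `∂p`); **`sum_map_plaqReadOutsPi`** — THE STOKES IDENTITY: the four read-outs SUM to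
  `η² • (covDComp x μ ν − covDComp x ν μ)` ((25)'s «= η(DA)(p)» — an identity of the DEFINITIONS `covDerivFwd`∕`conjR`, `η ≠ 0`);
* §2 (max-normed space `Ysp Λ η U₀ w w′ := WMax (𝔄 := 𝔸) (𝔅 := 𝔸) w w′ (covD Λ η U₀)`): `rdOut`∕`plaqReadOuts` = §1 through
  the identity `flat` (= `WMax.toPiL`); `weight_mul_norm_apply_le` + `norm_ext_le_div` (`‖A b‖ ≤ ‖A‖∕w₀` under a weight floor
  `w ≥ w₀ > 0`, zero off `Λ`), `weight_sq_mul_norm_covD_le` + `norm_covDComp_le_div` (`‖(D_κA_τ)(y)‖ ≤ ‖A‖∕w₀′²` under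
  `w′ ≥ w₀′ > 0`, zero off `covIdx Λ`), hence **`norm_rdOut_le`** (`≤ (η∕w₀)‖A‖`), its Ad-twisted form `norm_conjL_rdOut_le` for
  `U₀ ∈ U1` (`norm_conjR_le`), `sum_map_plaqReadOuts_eq` (Stokes on the carrier) and **`norm_sum_map_plaqReadOuts_le`**
  (`≤ (2η²∕w₀′²)‖A‖`);
* §3 END-II's rows LITERALLY for `ℓs := plaqReadOuts …`: **`hℓ_plaqReadOuts`** (`κr := η∕w₀`), **`hlen_plaqReadOuts`** (`m := 4`),
  **`hcurl_plaqReadOuts`** (`κc := 2η²∕w₀′²`) — i.e. `κr = κ̄r·η`, `κc = κ̄c·η²` with `κ̄r = 1∕w₀`, `κ̄c = 2∕w₀′²` (unit weights —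
  the designed `w = Lʲη_j = 1` on the slot's block inside `Ω_j` —: `κ̄r = 1`, `κ̄c = 2`); `readOut_constants_nonneg` (`hκ`, `hκc`)
  and **`smRows_of_etaFree`**: the host's `hs₁ ha hma` at every `0 < η ≤ 1` from the η-FREE numbers `2X ≤ c₁w₀′²zs`, `X ≤ c₂w₀zs`,
  `4X ≤ w₀`;
* §4 the END's target `M_n(ℂ)` (L²-operator norm) is served (`hℓ_plaqReadOuts_matrix` ∕ `hcurl_plaqReadOuts_matrix`, one
  `exact` each) + a joint-inhabitation `example` (unit weights; rule G-1: the weight floors are the only side conditions).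
CENSUS EFFECT (the owner's engines decide; R-ne7cp1-g36-12 (4)): in f2 (the host wrapper over link (3) of the chain) the
u-tuple's ABSTRACT carrier `𝒴` is READ as this space and `ℓs := plaqReadOuts …`; the R12∕R13 hypotheses `hκ hℓ hlen hκc hcurl`
are DERIVED here (W-i; expected T −5…−6); `hPu` stays; the weight floors enter ([N]∕[S]) and the (SM) numbers in η-free form
([N]).  THE OWNER's TWO HEADER SENTENCES, adopted verbatim for f1 AND f2: (i) the u-tuple's remaining W-a rows `h𝒢 hW hH₁ hH hι`
are from then on DISPLAYED IN PRINT's (19)-NORM on the block — `max{|A|·(Lʲη), |∇^η_{U₀}A|·(Lʲη)²}` = S65 f2c's `WMax` — a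
SHARPENING OF THE READING, class T unchanged; this is where [Balaban1985BackgroundPropagators] Thm 3.13 ∕ B11 Prop. 4 would
have to be proved; (ii) NOTHING of B11 (19)–(37) is discharged — the letters are OUR maps, their norms are arithmetic in OUR
instance.
NOT HERE: the w-tuple's weight read-outs `ℓw` on `Λw → 𝔄w` with frozen prefactors (R15a), any re-fire (generator lineage),
[dict] (node O).  NOTHING in the countdown moves; NE7c NOT PROVED; spine PROVED 0∕9.
-/

noncomputable section

open scoped BigOperators

namespace Summit.QuantumFields.BalabanUV.T4Continuum.ShellMeasureReadOutsMax

open Literature.MathematicalPhysics.QuantumFieldTheory.Balaban1983to89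
open B7Prop1Explicit (e U1)
open B7Eq78Linearization (conjR conjR_apply)
open B8Ineq132 (covDerivFwd norm_conjR_le)
open Summit.QuantumFields.BalabanUV.T4Continuum.ShellMeasureCommutatorLocGrad (ext ext_apply_of_mem ext_apply_of_not_mem)
open Summit.QuantumFields.BalabanUV.T4Continuum.ShellMeasureCommutatorCovDatum
open Summit.QuantumFields.BalabanUV.T4Continuum.ShellMeasureMultiGridNorms
open Summit.QuantumFields.BalabanUV.T4Continuum.ShellMeasureMultiGridNormsMax

export B7Prop1Explicit (Site)

variable {d : ℕ} {𝔸 : Type*} [NormedRing 𝔸] [NormedAlgebra ℂ 𝔸]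

/-! ## §1 The plaquette's four (twisted) lattice-angle read-outs on the flat space; the Stokes identity -/

section Flat

variable (Λ : Finset (Site d × Fin d)) (η : ℝ) (U₀ : Site d → Fin d → 𝔸ˣ)

/-- THE LATTICE-ANGLE READ-OUT at the bond `(x, μ)` on the flat space: `A ↦ η·(ext A)(x, μ)` (the bond letter the holonomy
word exponentiates; zero off `Λ`), as a continuous linear map. [folklore] -/
def rdOutPi (x : Site d) (μ : Fin d) : (↥Λ → 𝔸) →L[ℂ] 𝔸 := (η : ℂ) • extL Λ x μ

omit [NormedAlgebra ℂ 𝔸] in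
/-- Unfolding: `rdOutPi Λ η x μ A = η • ext Λ A x μ` (real scalar). [folklore] -/
theorem rdOutPi_apply [NormedAlgebra ℂ 𝔸] (x : Site d) (μ : Fin d) (A : ↥Λ → 𝔸) :
    rdOutPi Λ η x μ A = η • ext Λ A x μ := by
  rw [rdOutPi, smul_apply, extL_apply, Complex.coe_smul]

/-- THE FOUR READ-OUTS OF THE PLAQUETTE `(x; μ, ν)`: `η·A(x,μ)`, `Ad_{U₀(x,μ)}(η·A(x+e_μ,ν))`, `−Ad_{U₀(x,ν)}(η·A(x+e_ν,μ))`,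
`−η·A(x,ν)` — the second and third letters conjugated by the background bond variable that transports them back to `x`
(at `U₀ ≡ 1`: the plain four letters of `∂p`). DATA. [folklore] -/
def plaqReadOutsPi (x : Site d) (μ ν : Fin d) : List ((↥Λ → 𝔸) →L[ℂ] 𝔸) :=
  [rdOutPi Λ η x μ, (conjL (U₀ x μ)).comp (rdOutPi Λ η (x + e μ) ν),
    -((conjL (U₀ x ν)).comp (rdOutPi Λ η (x + e ν) μ)), -rdOutPi Λ η x ν]

omit [NormedAlgebra ℂ 𝔸] in
/-- The plaquette carries exactly four read-outs. [folklore] -/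
theorem length_plaqReadOutsPi [NormedAlgebra ℂ 𝔸] (x : Site d) (μ ν : Fin d) :
    (plaqReadOutsPi Λ η U₀ x μ ν).length = 4 := rfl

/-- **THE STOKES IDENTITY** ([Balaban1985Variational] (25) «= η(DA)(p)» as an identity of the DEFINITIONS): the four read-outs of
the plaquette `(x; μ, ν)` applied to `A` SUM to `η²·((D^η_{U₀,μ}A_ν)(x) − (D^η_{U₀,ν}A_μ)(x))`, `η ≠ 0`. [folklore] -/
theorem sum_map_plaqReadOutsPi (hη : η ≠ 0) (x : Site d) (μ ν : Fin d) (A : ↥Λ → 𝔸) :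
    ((plaqReadOutsPi Λ η U₀ x μ ν).map fun ℓ => ℓ A).sum =
      (η ^ 2) • (covDComp Λ η U₀ x μ ν A - covDComp Λ η U₀ x ν μ A) := by
  simp only [plaqReadOutsPi, List.map_cons, List.map_nil, List.sum_cons, List.sum_nil, add_zero,
    neg_apply, ContinuousLinearMap.comp_apply, rdOutPi_apply, conjL_apply, covDComp_apply,
    covDerivFwd]
  have hs : (η ^ 2 * η⁻¹ : ℝ) = η := by rw [pow_two, mul_inv_cancel_right₀ hη]
  have hc : ∀ (u : 𝔸ˣ) (X : 𝔸), conjR u (η • X) = η • conjR u X := fun u X => by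
    rw [conjR_apply, conjR_apply, mul_smul_comm, smul_mul_assoc]
  rw [hc, hc, smul_sub, smul_smul, smul_smul, hs, smul_sub, smul_sub]
  abel


end Flat

/-! ## §2 The read-outs on the max-normed space `WMax w w′ (covD Λ η U₀)` and their operator norms -/

section Max

variable (Λ : Finset (Site d × Fin d)) (η : ℝ) (U₀ : Site d → Fin d → 𝔸ˣ)
variable (w : ↥Λ → ℝ) (w' : ↥(covIdx Λ) → ℝ) [hw : Fact (∀ b, 0 < w b)] [hw' : Fact (∀ i, 0 < w' i)]

/-- THE (98) SOURCE SPACE over the block's bond set `Λ` for the `∇`-datum `covD Λ η U₀` and the weights `w`, `w′` — S65 f2c's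
`WMax` (an abbreviation; the carrier types are given explicitly so that the datum's instances elaborate at once). [folklore] -/
abbrev Ysp : Type _ := WMax (𝔄 := 𝔸) (𝔅 := 𝔸) w w' (covD Λ η U₀ :)

/-- The identity `Ysp … → (↥Λ → 𝔸)` as a continuous linear map (S65 f2c `WMax.toPiL`). [folklore] -/
abbrev flat : Ysp Λ η U₀ w w' →L[ℂ] (↥Λ → 𝔸) :=
  (WMax.toPiL w w' (covD Λ η U₀ :) : Ysp Λ η U₀ w w' ≃L[ℂ] (↥Λ → 𝔸))

/-- THE CARRIER IS COMPLETE when `𝔸` is (the identity to the flat product is a uniform equivalence, S65 f2c `WMax.toPiL`)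
— the END hosts' `[CompleteSpace 𝒴]`. [folklore] -/
instance instCompleteSpaceYsp [CompleteSpace 𝔸] : CompleteSpace (Ysp Λ η U₀ w w') :=
  (completeSpace_congr (e := (WMax.toPiL w w' (covD Λ η U₀ :)).toEquiv)
    (WMax.toPiL w w' (covD Λ η U₀ :)).isUniformEmbedding).2 inferInstance

omit hw hw' in
/-- `flat` is the identity on underlying functions. [folklore] -/
theorem flat_apply [Fact (∀ b, 0 < w b)] [Fact (∀ i, 0 < w' i)] (A : Ysp Λ η U₀ w w') (b : ↥Λ) :
    flat Λ η U₀ w w' A b = (show ↥Λ → 𝔸 from A) b := rfl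

/-- THE LATTICE-ANGLE READ-OUT at `(x, μ)` FROM THE (98) SOURCE SPACE (§1 through the identity). [folklore] -/
def rdOut (x : Site d) (μ : Fin d) : Ysp Λ η U₀ w w' →L[ℂ] 𝔸 := (rdOutPi Λ η x μ).comp (flat Λ η U₀ w w')

/-- THE PLAQUETTE'S FOUR READ-OUTS FROM THE (98) SOURCE SPACE (§1's list through the identity). DATA. [folklore] -/
def plaqReadOuts (x : Site d) (μ ν : Fin d) : List (Ysp Λ η U₀ w w' →L[ℂ] 𝔸) :=
  (plaqReadOutsPi Λ η U₀ x μ ν).map fun ℓ => ℓ.comp (flat Λ η U₀ w w')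

/-- Unfolding: `rdOut … x μ A = η • ext Λ A x μ`. [folklore] -/
theorem rdOut_apply (x : Site d) (μ : Fin d) (A : Ysp Λ η U₀ w w') :
    rdOut Λ η U₀ w w' x μ A = η • ext Λ (flat Λ η U₀ w w' A) x μ := by
  rw [rdOut, ContinuousLinearMap.comp_apply, rdOutPi_apply]

/-- The plaquette carries exactly four read-outs. [folklore] -/
theorem length_plaqReadOuts (x : Site d) (μ ν : Fin d) : (plaqReadOuts Λ η U₀ w w' x μ ν).length = 4 := by
  rw [plaqReadOuts, List.length_map, length_plaqReadOutsPi]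

/-- The read-out sum on the max-normed space is §1's sum at the underlying field. [folklore] -/
theorem sum_map_plaqReadOuts (x : Site d) (μ ν : Fin d) (A : Ysp Λ η U₀ w w') :
    ((plaqReadOuts Λ η U₀ w w' x μ ν).map fun ℓ => ℓ A).sum =
      ((plaqReadOutsPi Λ η U₀ x μ ν).map fun ℓ => ℓ (flat Λ η U₀ w w' A)).sum := by
  rw [plaqReadOuts, List.map_map]
  rfl

/-- **STOKES ON THE MAX-NORMED SPACE**: the four read-outs sum to `η²·(D_μA_ν − D_νA_μ)(x)`. [folklore] -/
theorem sum_map_plaqReadOuts_eq (hη : η ≠ 0) (x : Site d) (μ ν : Fin d) (A : Ysp Λ η U₀ w w') :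
    ((plaqReadOuts Λ η U₀ w w' x μ ν).map fun ℓ => ℓ A).sum =
      (η ^ 2) • (covDComp Λ η U₀ x μ ν (flat Λ η U₀ w w' A) - covDComp Λ η U₀ x ν μ (flat Λ η U₀ w w' A)) := by
  rw [sum_map_plaqReadOuts, sum_map_plaqReadOutsPi Λ η U₀ hη]

/-- A LETTER IS BELOW THE MAX NORM: `w b·‖A b‖ ≤ ‖A‖` (`|A|_{(−1)} ≤ ‖A‖_max`). [folklore] -/
theorem weight_mul_norm_apply_le (A : Ysp Λ η U₀ w w') (b : ↥Λ) : w b * ‖flat Λ η U₀ w w' A b‖ ≤ ‖A‖ := by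
  have h := WSup.norm_apply_le w 1 (show WSup w 1 𝔸 from A) b
  rw [pow_one] at h
  exact h.trans (WMax.norm_wsup_le w w' _ A)

/-- UNDER A WEIGHT FLOOR `w ≥ w₀ > 0`: every letter of the extended field is `≤ ‖A‖∕w₀` (zero off `Λ`). [folklore] -/
theorem norm_ext_le_div (A : Ysp Λ η U₀ w w') {w₀ : ℝ} (hw₀ : 0 < w₀) (hfl : ∀ b, w₀ ≤ w b) (x : Site d)
    (μ : Fin d) : ‖ext Λ (flat Λ η U₀ w w' A) x μ‖ ≤ ‖A‖ / w₀ := by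
  by_cases h : (x, μ) ∈ Λ
  · rw [ext_apply_of_mem Λ _ h, le_div_iff₀ hw₀]
    calc ‖flat Λ η U₀ w w' A ⟨(x, μ), h⟩‖ * w₀
        ≤ ‖flat Λ η U₀ w w' A ⟨(x, μ), h⟩‖ * w ⟨(x, μ), h⟩ := by gcongr; exact hfl _
      _ = w ⟨(x, μ), h⟩ * ‖flat Λ η U₀ w w' A ⟨(x, μ), h⟩‖ := mul_comm _ _
      _ ≤ ‖A‖ := weight_mul_norm_apply_le Λ η U₀ w w' A _
  · rw [ext_apply_of_not_mem Λ _ h, norm_zero]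
    positivity

/-- A COVARIANT DIFFERENCE IS BELOW THE MAX NORM: `w′ i²·‖(covD A) i‖ ≤ ‖A‖` (`|∇A|_{(−2)} ≤ ‖A‖_max`). [folklore] -/
theorem weight_sq_mul_norm_covD_le (A : Ysp Λ η U₀ w w') (i : ↥(covIdx Λ)) :
    w' i ^ 2 * ‖covD Λ η U₀ (flat Λ η U₀ w w' A) i‖ ≤ ‖A‖ :=
  (WSup.norm_apply_le w' 2 (show WSup w' 2 𝔸 from covD Λ η U₀ (flat Λ η U₀ w w' A)) i).trans
    (WMax.norm_deriv_le w w' _ A)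

/-- UNDER A WEIGHT FLOOR `w′ ≥ w₀′ > 0`: every forward covariant difference of the extended field is `≤ ‖A‖∕w₀′²` (zero off
`covIdx Λ`, `covDerivFwd_ext_eq_zero`). [folklore] -/
theorem norm_covDComp_le_div (A : Ysp Λ η U₀ w w') {w₀' : ℝ} (hw₀' : 0 < w₀') (hfl' : ∀ i, w₀' ≤ w' i)
    (y : Site d) (κ τ : Fin d) : ‖covDComp Λ η U₀ y κ τ (flat Λ η U₀ w w' A)‖ ≤ ‖A‖ / w₀' ^ 2 := by
  by_cases h : (y, κ, τ) ∈ covIdx Λ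
  · have hi : covDComp Λ η U₀ y κ τ (flat Λ η U₀ w w' A) = covD Λ η U₀ (flat Λ η U₀ w w' A) ⟨(y, κ, τ), h⟩ := by
      rw [covDComp_apply, covD_apply]
    rw [hi, le_div_iff₀ (pow_pos hw₀' 2)]
    calc ‖covD Λ η U₀ (flat Λ η U₀ w w' A) ⟨(y, κ, τ), h⟩‖ * w₀' ^ 2
        ≤ ‖covD Λ η U₀ (flat Λ η U₀ w w' A) ⟨(y, κ, τ), h⟩‖ * w' ⟨(y, κ, τ), h⟩ ^ 2 := by
          gcongr; exact hfl' _
      _ = w' ⟨(y, κ, τ), h⟩ ^ 2 * ‖covD Λ η U₀ (flat Λ η U₀ w w' A) ⟨(y, κ, τ), h⟩‖ := mul_comm _ _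
      _ ≤ ‖A‖ := weight_sq_mul_norm_covD_le Λ η U₀ w w' A _
  · rw [covDComp_apply, covDerivFwd_ext_eq_zero Λ η U₀ h, norm_zero]
    positivity

/-- **THE READ-OUT NORM**: `‖rdOut … x μ A‖ ≤ (η∕w₀)·‖A‖` (`0 ≤ η`, weight floor `w ≥ w₀ > 0`). [folklore] -/
theorem norm_rdOut_le (hη : 0 ≤ η) {w₀ : ℝ} (hw₀ : 0 < w₀) (hfl : ∀ b, w₀ ≤ w b) (x : Site d) (μ : Fin d)
    (A : Ysp Λ η U₀ w w') : ‖rdOut Λ η U₀ w w' x μ A‖ ≤ η / w₀ * ‖A‖ := by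
  rw [rdOut_apply]
  calc ‖η • ext Λ (flat Λ η U₀ w w' A) x μ‖ ≤ ‖η‖ * ‖ext Λ (flat Λ η U₀ w w' A) x μ‖ := norm_smul_le _ _
    _ ≤ η * (‖A‖ / w₀) := by
        rw [Real.norm_of_nonneg hη]
        exact mul_le_mul_of_nonneg_left (norm_ext_le_div Λ η U₀ w w' A hw₀ hfl x μ) hη
    _ = η / w₀ * ‖A‖ := by ring

/-- **THE TWISTED READ-OUT NORM**: conjugation by a background bond variable in `U1` does not increase it. [folklore] -/
theorem norm_conjL_rdOut_le [NormOneClass 𝔸] (hη : 0 ≤ η) (h₀ : ∀ y κ, U₀ y κ ∈ U1 𝔸) {w₀ : ℝ} (hw₀ : 0 < w₀)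
    (hfl : ∀ b, w₀ ≤ w b) (y : Site d) (κ : Fin d) (x : Site d) (μ : Fin d) (A : Ysp Λ η U₀ w w') :
    ‖conjL (U₀ y κ) (rdOut Λ η U₀ w w' x μ A)‖ ≤ η / w₀ * ‖A‖ := by
  rw [conjL_apply]
  exact (norm_conjR_le (h₀ y κ) _).trans (norm_rdOut_le Λ η U₀ w w' hη hw₀ hfl x μ A)

/-- **THE CURL NORM** (Stokes + the `∇`-half of the max norm): `‖Σ (read-outs of ∂p) A‖ ≤ (2η²∕w₀′²)·‖A‖` (`0 < η`, floor
`w′ ≥ w₀′ > 0`). [folklore] -/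
theorem norm_sum_map_plaqReadOuts_le (hη : 0 < η) {w₀' : ℝ} (hw₀' : 0 < w₀') (hfl' : ∀ i, w₀' ≤ w' i) (x : Site d)
    (μ ν : Fin d) (A : Ysp Λ η U₀ w w') :
    ‖((plaqReadOuts Λ η U₀ w w' x μ ν).map fun ℓ => ℓ A).sum‖ ≤ 2 * η ^ 2 / w₀' ^ 2 * ‖A‖ := by
  rw [sum_map_plaqReadOuts_eq Λ η U₀ w w' hη.ne']
  have h1 := norm_covDComp_le_div Λ η U₀ w w' A hw₀' hfl' x μ ν
  have h2 := norm_covDComp_le_div Λ η U₀ w w' A hw₀' hfl' x ν μ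
  calc ‖(η ^ 2) • (covDComp Λ η U₀ x μ ν (flat Λ η U₀ w w' A) - covDComp Λ η U₀ x ν μ (flat Λ η U₀ w w' A))‖
      ≤ ‖η ^ 2‖ * ‖covDComp Λ η U₀ x μ ν (flat Λ η U₀ w w' A) - covDComp Λ η U₀ x ν μ (flat Λ η U₀ w w' A)‖ :=
        norm_smul_le _ _
    _ ≤ η ^ 2 * (‖A‖ / w₀' ^ 2 + ‖A‖ / w₀' ^ 2) := by
        rw [Real.norm_of_nonneg (pow_nonneg hη.le 2)]
        exact mul_le_mul_of_nonneg_left ((norm_sub_le _ _).trans (add_le_add h1 h2)) (pow_nonneg hη.le 2)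
    _ = 2 * η ^ 2 / w₀' ^ 2 * ‖A‖ := by ring

/-! ## §3 END-II's read-out rows R12∕R13 LITERALLY, and the (SM) rows from η-free numbers -/

/-- **ROW `hℓ`** (R12): every read-out of every plaquette has op-norm `≤ κr := η∕w₀` (`0 ≤ η`, `U₀ ∈ U1`, floor `w ≥ w₀ > 0`).
[folklore] -/
theorem hℓ_plaqReadOuts [NormOneClass 𝔸] (hη : 0 ≤ η) (h₀ : ∀ y κ, U₀ y κ ∈ U1 𝔸) {w₀ : ℝ} (hw₀ : 0 < w₀)
    (hfl : ∀ b, w₀ ≤ w b) (x : Site d) (μ ν : Fin d) :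
    ∀ ℓ ∈ plaqReadOuts Λ η U₀ w w' x μ ν, ∀ A, ‖ℓ A‖ ≤ η / w₀ * ‖A‖ := by
  intro ℓ hℓ A
  simp only [plaqReadOuts, plaqReadOutsPi, List.map_cons, List.map_nil, List.mem_cons, List.not_mem_nil,
    or_false] at hℓ
  rcases hℓ with rfl | rfl | rfl | rfl
  · exact norm_rdOut_le Λ η U₀ w w' hη hw₀ hfl x μ A
  · rw [ContinuousLinearMap.comp_apply, ContinuousLinearMap.comp_apply]
    exact norm_conjL_rdOut_le Λ η U₀ w w' hη h₀ hw₀ hfl x μ (x + e μ) ν A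
  · rw [ContinuousLinearMap.comp_apply, neg_apply, norm_neg, ContinuousLinearMap.comp_apply]
    exact norm_conjL_rdOut_le Λ η U₀ w w' hη h₀ hw₀ hfl x ν (x + e ν) μ A
  · rw [ContinuousLinearMap.comp_apply, neg_apply, norm_neg]
    exact norm_rdOut_le Λ η U₀ w w' hη hw₀ hfl x ν A

/-- **ROW `hlen`** (R12): `length ≤ 4`. [folklore] -/
theorem hlen_plaqReadOuts (x : Site d) (μ ν : Fin d) : (plaqReadOuts Λ η U₀ w w' x μ ν).length ≤ 4 :=
  (length_plaqReadOuts Λ η U₀ w w' x μ ν).le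

/-- **ROW `hcurl`** (R13, F-ne7cp1-g31-1): the curl read-out has op-norm `≤ κc := 2η²∕w₀′²`. [folklore] -/
theorem hcurl_plaqReadOuts (hη : 0 < η) {w₀' : ℝ} (hw₀' : 0 < w₀') (hfl' : ∀ i, w₀' ≤ w' i) (x : Site d)
    (μ ν : Fin d) : ∀ A : Ysp Λ η U₀ w w',
    ‖((plaqReadOuts Λ η U₀ w w' x μ ν).map fun ℓ => ℓ A).sum‖ ≤ 2 * η ^ 2 / w₀' ^ 2 * ‖A‖ :=
  norm_sum_map_plaqReadOuts_le Λ η U₀ w w' hη hw₀' hfl' x μ ν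

end Max

section Numbers

variable {η : ℝ}

/-- **ROWS `hκ`, `hκc`**: the read-out constants are nonnegative. [folklore] -/
theorem readOut_constants_nonneg (hη : 0 ≤ η) {w₀ w₀' : ℝ} (hw₀ : 0 < w₀) (hw₀' : 0 < w₀') :
    0 ≤ η / w₀ ∧ 0 ≤ 2 * η ^ 2 / w₀' ^ 2 :=
  ⟨div_nonneg hη hw₀.le, div_nonneg (mul_nonneg two_pos.le (pow_nonneg hη 2)) (pow_nonneg hw₀'.le 2)⟩

/-- **THE (SM) ROWS FROM η-FREE NUMBERS.**  With `κr := η∕w₀`, `κc := 2η²∕w₀′²`, `m := 4`, the END host's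
`hs₁ : κc·X ≤ c₁·η²·zs`, `ha : κr·X ≤ c₂·η·zs`, `hma : m·(κr·X) ≤ 1` hold at EVERY `0 < η ≤ 1` as soon as the η-free numbers
`2X ≤ c₁·w₀′²·zs`, `X ≤ c₂·w₀·zs`, `4X ≤ w₀` do (`X ≥ 0` = the host's Landau amplitude): the LIFT RULE's level-free content.
[folklore] -/
theorem smRows_of_etaFree {w₀ w₀' X c₁ c₂ zs : ℝ} (hη : 0 < η) (hη1 : η ≤ 1) (hw₀ : 0 < w₀) (hw₀' : 0 < w₀')
    (hX : 0 ≤ X) (hs₁' : 2 * X ≤ c₁ * w₀' ^ 2 * zs) (ha' : X ≤ c₂ * w₀ * zs) (hma' : 4 * X ≤ w₀) :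
    2 * η ^ 2 / w₀' ^ 2 * X ≤ c₁ * η ^ 2 * zs ∧ η / w₀ * X ≤ c₂ * η * zs ∧ ((4 : ℕ) : ℝ) * (η / w₀ * X) ≤ 1 := by
  have hw2 : 0 < w₀' ^ 2 := pow_pos hw₀' 2
  have hη2 : 0 ≤ η ^ 2 := pow_nonneg hη.le 2
  refine ⟨?_, ?_, ?_⟩
  · rw [div_mul_eq_mul_div, div_le_iff₀ hw2]
    calc 2 * η ^ 2 * X = η ^ 2 * (2 * X) := by ring
      _ ≤ η ^ 2 * (c₁ * w₀' ^ 2 * zs) := mul_le_mul_of_nonneg_left hs₁' hη2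
      _ = c₁ * η ^ 2 * zs * w₀' ^ 2 := by ring
  · rw [div_mul_eq_mul_div, div_le_iff₀ hw₀]
    calc η * X ≤ η * (c₂ * w₀ * zs) := mul_le_mul_of_nonneg_left ha' hη.le
      _ = c₂ * η * zs * w₀ := by ring
  · have h4 : ((4 : ℕ) : ℝ) * (η / w₀ * X) = η * (4 * X) / w₀ := by push_cast; ring
    rw [h4, div_le_iff₀ hw₀, one_mul]
    calc η * (4 * X) ≤ 1 * w₀ := mul_le_mul hη1 hma' (by positivity) zero_le_one
      _ = w₀ := one_mul _

end Numbers

/-! ## §4 The END's target `M_n(ℂ)` and a joint-inhabitation example -/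

section Matrix

open scoped Matrix.Norms.L2Operator

variable {n : Type*} [Fintype n] [DecidableEq n] [Nonempty n]
variable (Λ : Finset (Site d × Fin d)) (η : ℝ) (U₀ : Site d → Fin d → (Matrix n n ℂ)ˣ)
variable (w : ↥Λ → ℝ) (w' : ↥(covIdx Λ) → ℝ) [Fact (∀ b, 0 < w b)] [Fact (∀ i, 0 < w' i)]

/-- ROW `hℓ` AT THE END's TARGET `M_n(ℂ)` (L²-operator norm): `plaqReadOuts … : List (Ysp … →L[ℂ] Matrix n n ℂ)` — the
host's `ℓs p` type — with `κr := η∕w₀`. [folklore] -/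
theorem hℓ_plaqReadOuts_matrix (hη : 0 ≤ η) (h₀ : ∀ y κ, U₀ y κ ∈ U1 (Matrix n n ℂ)) {w₀ : ℝ} (hw₀ : 0 < w₀)
    (hfl : ∀ b, w₀ ≤ w b) (x : Site d) (μ ν : Fin d) :
    ∀ ℓ ∈ plaqReadOuts Λ η U₀ w w' x μ ν, ∀ A, ‖ℓ A‖ ≤ η / w₀ * ‖A‖ :=
  hℓ_plaqReadOuts Λ η U₀ w w' hη h₀ hw₀ hfl x μ ν

omit [Nonempty n] in
/-- ROW `hcurl` AT THE END's TARGET `M_n(ℂ)`, `κc := 2η²∕w₀′²`. [folklore] -/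
theorem hcurl_plaqReadOuts_matrix (hη : 0 < η) {w₀' : ℝ} (hw₀' : 0 < w₀') (hfl' : ∀ i, w₀' ≤ w' i) (x : Site d)
    (μ ν : Fin d) : ∀ A : Ysp Λ η U₀ w w',
    ‖((plaqReadOuts Λ η U₀ w w' x μ ν).map fun ℓ => ℓ A).sum‖ ≤ 2 * η ^ 2 / w₀' ^ 2 * ‖A‖ :=
  hcurl_plaqReadOuts Λ η U₀ w w' hη hw₀' hfl' x μ ν

/-- JOINT INHABITATION (rule G-1): with UNIT weights (the designed `w = Lʲη_j = 1` on the slot's block) the only side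
conditions are met with `w₀ = w₀′ = 1`, and the three rows read `κr = η`, `m = 4`, `κc = 2η²` — the LIFT-RULE profiles
`κ̄r·η_j`, `κ̄c·η_j²` with `κ̄r = 1`, `κ̄c = 2` — for ANY bond set, ANY `U1`-valued background, EVERY plaquette. [folklore] -/
example (hη : 0 < η) (h₀ : ∀ y κ, U₀ y κ ∈ U1 (Matrix n n ℂ)) (x : Site d) (μ ν : Fin d) :
    (∀ ℓ ∈ plaqReadOuts Λ η U₀ (unitW ↥Λ) (unitW ↥(covIdx Λ)) x μ ν, ∀ A, ‖ℓ A‖ ≤ η * ‖A‖) ∧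
      (plaqReadOuts Λ η U₀ (unitW ↥Λ) (unitW ↥(covIdx Λ)) x μ ν).length ≤ 4 ∧
      (∀ A, ‖((plaqReadOuts Λ η U₀ (unitW ↥Λ) (unitW ↥(covIdx Λ)) x μ ν).map fun ℓ => ℓ A).sum‖ ≤
        2 * η ^ 2 * ‖A‖) := by
  refine ⟨fun ℓ hℓ A => ?_, hlen_plaqReadOuts Λ η U₀ _ _ x μ ν, fun A => ?_⟩
  · have h := hℓ_plaqReadOuts Λ η U₀ (unitW ↥Λ) (unitW ↥(covIdx Λ)) hη.le h₀ one_pos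
      (fun b => (unitW_apply _ b).ge) x μ ν ℓ hℓ A
    rwa [div_one] at h
  · have h := hcurl_plaqReadOuts Λ η U₀ (unitW ↥Λ) (unitW ↥(covIdx Λ)) hη one_pos
      (fun i => (unitW_apply _ i).ge) x μ ν A
    rwa [one_pow, div_one] at h

end Matrix

end Summit.QuantumFields.BalabanUV.T4Continuum.ShellMeasureReadOutsMax
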